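import Literature.Analysis.FunctionSpaces.TorusClassicalNSVStability

/-!
# `V`-stability of strong solutions with integrable coefficients (tools stub `stub_vStabilityTools`
# of block N-E, line `ergodic-budget-selection-closing`, crux `BaireTransfer.DenseLoudDesignerForces`,
# stmt-AnomalousDissipation-1143)

Summit-side wrapper, at `d = Fin 3`, of the Literature estimate
`Literature.Analysis.FunctionSpaces.Torus.IsClassicalNSSolutionOn.h1_sub_le_mul_of_integral_laplacian_sq_le`
(`Literature/Analysis/FunctionSpaces/TorusClassicalNSVStability.lean`): for `ν > 0`, `M₁`, `Y` and
`τ > 0` there is `C = C(ν, M₁, Y, τ)` such that two classical Navier–Stokes solutions on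
`[a, a + τ] × T³` with the same force, zero-mean slices, enstrophies `≤ M₁` and
`∫ₐ^{a+τ} ‖Δu₂‖₂² ≤ Y` satisfy `‖w(t)‖²_{L²} + ‖∇w(t)‖₂² ≤ C (‖w(a)‖²_{L²} + ‖∇w(a)‖₂²)`,
`w = u₁ − u₂` — continuous dependence in `V` with constants depending on the two solutions only
through `M₁` and `Y` (the coefficient `‖Δu₂(s)‖₂²` being merely integrable in time), the form
needed by the closing argument of the line on bounded invariant sets of `V`.  The mathematics
(three `L⁴ × L⁴ × L²` flux bounds absorbed by the dissipation, Grönwall with a continuous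
integrable coefficient) is in the two Literature files
`TorusClassicalNSVStabilityFlux.lean` / `TorusClassicalNSVStability.lean`.

References: Constantin–Foias, *Navier–Stokes Equations* (1988) Thm. 10.2, (10.7);
Robinson–Rodrigo–Sadowski, *The Three-Dimensional Navier–Stokes Equations* (CUP 2016) §6.3.
-/

-- `Summit.<Summit>.<Problem>` is the tree's mandated summit-side namespace (CONVENTIONS §2); for this
-- single-conjunct summit the two coincide, so the duplicate is deliberate.
set_option linter.dupNamespace false

noncomputable section

open scoped BigOperators Topology ENNReal InnerProductSpace
open Filter Set Function MeasureTheory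

namespace Summit.AnomalousDissipation.AnomalousDissipation.Theorems.DenseLoudDesignerForces.Ergodic

open Literature.Analysis.FunctionSpaces Literature.Analysis.FunctionSpaces.Torus
open Literature.Analysis.FluidPDE Literature.Analysis.FluidPDE.Torus

/-- **Tools stub N-E — `V`-stability with integrable coefficients** (registered tools stub
`stub_vStabilityTools` of block N, crux stmt-AnomalousDissipation-1143, line
`ergodic-budget-selection-closing`).  For `ν > 0` and `M₁, Y, τ` (`τ > 0`) there is `C` such that for any
two classical solutions of NS_ν with the same force on `[a, a + τ] × T³`, zero-mean slices,
`‖∇u₁(t)‖₂², ‖∇u₂(t)‖₂² ≤ M₁` on the interval and `∫ₐ^{a+τ} ‖Δu₂(s)‖₂² ds ≤ Y`, the difference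
`w = u₁ − u₂` obeys `∫‖w(t)‖² + ‖∇w(t)‖₂² ≤ C (∫‖w(a)‖² + ‖∇w(a)‖₂²)` for all `t ∈ [a, a + τ]`
(`Torus.IsClassicalNSSolutionOn.h1_sub_le_mul_of_integral_laplacian_sq_le` at `d = Fin 3`; Constantin–Foias 1988,
Thm. 10.2 (10.7), one level up in `V`). [cite: ConstantinFoiasNSE1988, Ch. 10 Thm. 10.2 (10.7)] -/
theorem stub_vStabilityTools {ν : ℝ} (hν : 0 < ν) (M₁ Y τ : ℝ) (hτ : 0 < τ) :
    ∃ C : ℝ, ∀ {a : ℝ} {f u₁ u₂ : ℝ → (UnitAddTorus (Fin 3)) → (EuclideanSpace ℝ (Fin 3))}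
      {p₁ p₂ : ℝ → (UnitAddTorus (Fin 3)) → ℝ},
      IsClassicalNSSolutionOn (Icc a (a + τ)) ν f u₁ p₁ → IsClassicalNSSolutionOn (Icc a (a + τ)) ν f u₂ p₂ →
      (∀ t ∈ Icc a (a + τ), HasZeroMean (u₁ t)) → (∀ t ∈ Icc a (a + τ), HasZeroMean (u₂ t)) →
      (∀ t ∈ Icc a (a + τ), gradNormSq (u₁ t) ≤ M₁) → (∀ t ∈ Icc a (a + τ), gradNormSq (u₂ t) ≤ M₁) →
      (∫ s in a..(a + τ), (∫ x, ‖laplacian (u₂ s) x‖ ^ 2) ≤ Y) →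
      ∀ t ∈ Icc a (a + τ), (∫ x, ‖u₁ t x - u₂ t x‖ ^ 2) + gradNormSq (fun y => u₁ t y - u₂ t y) ≤
        C * ((∫ x, ‖u₁ a x - u₂ a x‖ ^ 2) + gradNormSq (fun y => u₁ a y - u₂ a y)) :=
  IsClassicalNSSolutionOn.h1_sub_le_mul_of_integral_laplacian_sq_le (d := Fin 3) (Fintype.card_fin 3)
    hν M₁ Y τ hτ

end Summit.AnomalousDissipation.AnomalousDissipation.Theorems.DenseLoudDesignerForces.Ergodic

end
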